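import Literature.Barriers.Parity.SiegelZeroDichotomy
import HarnessLib
import Summits.Parity.GeneralizedHardyLittlewood.Theorems.UnboundedSiegelZeros

/-!
# `SiegelZeroDichotomy` — companion ("Proofs") file: the status of `Literature.Barriers.Parity.UnboundedSiegelZeros`

Topic `Literature/Barriers/Parity`, companion of the catalogue entry `SiegelZeroDichotomy.lean`
(Heath-Brown's Siegel-zero dichotomy, D-0021), kept separate so that the statement file is
unchanged. All declarations in this file are PROVED theorems; no new definitions.

`Literature.Barriers.Parity.UnboundedSiegelZeros` ("for every `η₀`, `q₀` there is a Siegel zero of quality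
`η ≥ η₀` attached to a conductor `q ≥ q₀`") is NOT a result of the cited source and has no
discharge `UnboundedSiegelZeros_holds`: it is the standing HYPOTHESIS of the dichotomy
`Literature.Barriers.SiegelZeroTwinPrimes := UnboundedSiegelZeros → TwinPrimeConjecture`. The source is
explicit (arXiv pages): Abstract (p. 2) "Assuming that Siegel zeros exist, we prove a hybrid
version of the Chowla and Hardy–Littlewood prime tuples conjectures"; §1 (p. 3, before
Definition 1.4) "some progress on this conjecture can be made under an opposing hypothesis, namely
the existence of a Siegel zero"; Theorem 1.5 (p. 3) "Suppose that one has a Siegel zero `β` with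
associated conductor `q_χ` and quality `η`"; and the only unconditional information printed is
"(1.4): From Siegel's theorem we have the (ineffective) upper bound `η ≪_ε q_χ^ε`"
[cite: TaoTeravainen2021, Abstract, §1 (1.4), Definition 1.4, Theorem 1.5]. What the tree CAN say
about the hypothesis is proved here:

* `IsSiegelZero.one_half_lt_re`, `IsSiegelZero.re_lt_one` — a Siegel zero of quality `η ≥ 10`
  attached to a conductor `q ≥ 2` is a real zero `β = 1 - 1/(η log q)` of `L(s, χ)` with
  `1/2 < β < 1` (indeed `η log q ≥ 10 log 2 > 2`).
* `not_unboundedSiegelZeros_of_generalizedRiemannHypothesis` — hence the tree's Generalised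
  Riemann Hypothesis `Literature.NumberTheory.LFunctions.GeneralizedRiemannHypothesis` (rh.S02: every zero of `L(s, χ)` with
  `0 < Re s < 1` has `Re s = 1/2`) REFUTES `UnboundedSiegelZeros` (the rh.S34 version
  `not_unboundedSiegelZeros_of_noSiegelZeros` is in the statement file). The hypothesis is thus
  the negation of a consequence of GRH: expected false, refutable only by progress on rh.S02/rh.S34.
* `not_unboundedSiegelZeros_iff` — its negation unfolds to "the quality of Siegel zeros is
  bounded at large conductors" (`∃ η₀ q₀, ∀ q ≥ q₀, IsSiegelZero χ η → η < η₀`), an effective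
  Siegel-type bound, which is open: only the ineffective `η ≪_ε q_χ^ε` is known
  [cite: TaoTeravainen2021, (1.4)]. Neither `UnboundedSiegelZeros` nor its negation is a theorem
  in print.
* `IsSiegelZero.three_le`, `not_unboundedSiegelZeros_iff_zeroFree`, `zeroFree_of_noSiegelZeros`
  (appended) — a Siegel zero forces `q ≥ 3` (no `2 ≤ q` side condition is ever needed), and the
  negation is equivalently a ZERO-FREE INTERVAL: `η₀ > 0`, `q₀` with `L(σ, χ) ≠ 0` for all
  `q ≥ q₀`, primitive quadratic `χ mod q`, real `σ ∈ [1 - 1/(η₀ log q), 1)` (every real zero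
  there is a Siegel zero of quality `1/((1 - σ) log q) ≥ η₀` in the sense of Definition 1.4).

## References

* T. Tao, J. Teräväinen, *The Hardy–Littlewood–Chowla conjecture in the presence of a Siegel
  zero*, J. London Math. Soc. (2) 106 (2022), 3317–3378, arXiv:2109.06291 — read: Abstract
  (p. 2), §1 with Definition 1.4, (1.4) and Theorem 1.5 (p. 3) [TaoTeravainen2021].
* H. Davenport, *Multiplicative Number Theory*, ch. 14, 20, 21 (GRH and Siegel zeros; the
  sources of rh.S02/rh.S34 in `Literature/NumberTheory/LFunctions/RHWave0.lean`) [folklore].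
-/

noncomputable section

namespace Literature.Barriers.Parity

/-- For a Siegel zero of quality `η` (so `η ≥ 10`) attached to a conductor `q ≥ 2`,
`η log q > 2` (as `log 2 > 0.69`). [folklore] -/
theorem IsSiegelZero.two_lt_mul_log {q : ℕ} [NeZero q] {χ : DirichletCharacter ℂ q} {η : ℝ}
    (h : IsSiegelZero χ η) (hq : 2 ≤ q) : 2 < η * Real.log q := by
  have hq2 : (2 : ℝ) ≤ q := by exact_mod_cast hq
  have hlq : (0.6931471803 : ℝ) < Real.log q :=
    Real.log_two_gt_d9.trans_le (Real.log_le_log two_pos hq2)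
  have h1 : (10 : ℝ) * 0.6931471803 ≤ η * Real.log q :=
    mul_le_mul h.ten_le hlq.le (by norm_num) (by linarith [h.ten_le])
  linarith

/-- A Siegel zero `β = 1 - 1/(η log q)` attached to a conductor `q ≥ 2` lies to the right of the
critical line: `1/2 < β`. [folklore] -/
theorem IsSiegelZero.one_half_lt_re {q : ℕ} [NeZero q] {χ : DirichletCharacter ℂ q} {η : ℝ}
    (h : IsSiegelZero χ η) (hq : 2 ≤ q) : (1 : ℝ) / 2 < 1 - 1 / (η * Real.log q) := by
  have hbig := h.two_lt_mul_log hq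
  have hpos : 0 < η * Real.log q := by linarith
  have h3 : 1 / (η * Real.log q) < 1 / 2 := by
    rw [div_lt_div_iff₀ hpos two_pos]
    linarith
  linarith

/-- A Siegel zero `β = 1 - 1/(η log q)` attached to a conductor `q ≥ 2` satisfies `β < 1`.
[folklore] -/
theorem IsSiegelZero.re_lt_one {q : ℕ} [NeZero q] {χ : DirichletCharacter ℂ q} {η : ℝ}
    (h : IsSiegelZero χ η) (hq : 2 ≤ q) : 1 - 1 / (η * Real.log q) < (1 : ℝ) := by
  have hbig := h.two_lt_mul_log hq
  have hpos : 0 < η * Real.log q := by linarith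
  have h4 : 0 < 1 / (η * Real.log q) := by positivity
  linarith

/-- **GRH refutes `UnboundedSiegelZeros`.** The tree's Generalised Riemann Hypothesis for
Dirichlet `L`-functions (`Literature.NumberTheory.LFunctions.GeneralizedRiemannHypothesis`, rh.S02) excludes real zeros in
`(1/2, 1)`, while a Siegel zero of quality `η ≥ 10` at a conductor `q ≥ 2` is such a zero
(`IsSiegelZero.one_half_lt_re`, `IsSiegelZero.re_lt_one`). So `UnboundedSiegelZeros` — the
standing hypothesis "Assuming that Siegel zeros exist" / "an opposing hypothesis, namely the
existence of a Siegel zero" of the source — is the negation of a consequence of GRH and admits no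
discharge; compare the rh.S34 version `not_unboundedSiegelZeros_of_noSiegelZeros`.
[cite: TaoTeravainen2021, Abstract and §1 (before Definition 1.4)] -/
theorem not_unboundedSiegelZeros_of_generalizedRiemannHypothesis
    (h : Literature.NumberTheory.LFunctions.GeneralizedRiemannHypothesis) : ¬ Summit.Parity.GeneralizedHardyLittlewood.UnboundedSiegelZeros := by
  intro hU
  obtain ⟨q, hq0, χ, η, hq, -, hS⟩ := hU 10 2
  have hlo := hS.one_half_lt_re hq
  have hhi := hS.re_lt_one hq
  have hre := h q χ _ hS.2.2.2 (by rw [Complex.ofReal_re]; linarith)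
    (by rw [Complex.ofReal_re]; linarith)
  rw [Complex.ofReal_re] at hre
  linarith

/-- **What a refutation of the hypothesis is.** `¬ UnboundedSiegelZeros` unfolds to: the quality
of Siegel zeros is bounded at large conductors — there are `η₀`, `q₀` such that every Siegel zero
attached to a conductor `q ≥ q₀` has quality `η < η₀` (an effective Siegel-type bound; only the
ineffective "`η ≪_ε q_χ^ε`" of (1.4) is known). This is the conclusion of the no-go theorems
`SiegelZeroTwinPrimes.disproof_bounds_quality`, `robustHLFailure_eliminates`,
`robustChowlaFailure_eliminates` of the statement file. [cite: TaoTeravainen2021, (1.4)] -/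
theorem not_unboundedSiegelZeros_iff :
    ¬ Summit.Parity.GeneralizedHardyLittlewood.UnboundedSiegelZeros ↔
      ∃ η₀ : ℝ, ∃ q₀ : ℕ, ∀ (q : ℕ) [NeZero q] (χ : DirichletCharacter ℂ q) (η : ℝ),
        q₀ ≤ q → IsSiegelZero χ η → η < η₀ := by
  constructor
  · intro hnot
    unfold Summit.Parity.GeneralizedHardyLittlewood.UnboundedSiegelZeros at hnot
    simp only [not_forall, not_exists, not_and] at hnot
    obtain ⟨η₀, q₀, hη⟩ := hnot
    refine ⟨η₀, q₀, fun q inst χ η hq hS => ?_⟩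
    by_contra hlt
    exact hη q inst χ η hq (not_lt.mp hlt) hS
  · rintro ⟨η₀, q₀, hb⟩ hU
    obtain ⟨q, inst, χ, η, hq, hη, hS⟩ := hU η₀ q₀
    exact absurd (hb q χ η hq hS) (not_lt.mpr hη)

/-- The no-go of the statement file in hypothesis form: a disproof of the twin prime conjecture
refutes `UnboundedSiegelZeros` (unconditionally modulo the tree's Matomäki–Merikoski fact), i.e.
proves the large-conductor quality bound of `not_unboundedSiegelZeros_iff`.
[cite: MatomakiMerikoski2023, Corollary 1.1(i)] -/
theorem not_unboundedSiegelZeros_of_not_twinPrime (hMM : MatomakiMerikoski2023_fixedShift)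
    (hno : ¬ Literature.NumberTheory.Sieve.TwinPrimeConjecture) : ¬ Summit.Parity.GeneralizedHardyLittlewood.UnboundedSiegelZeros :=
  fun hU => hno (SiegelZeroTwinPrimes_of_matomakiMerikoski hMM hU)

/-! ### Conductor `≥ 3`, and the zero-free form of `¬ UnboundedSiegelZeros` -/

/-- A Siegel zero lives at a conductor `q ≥ 3`: at `q = 1` the defining clause reads `ζ(1) = 0`
(`log 1 = 0`, Mathlib's junk value `1 / 0 = 0`, `DirichletCharacter.LFunction_modOne_eq`,
`riemannZeta_one_ne_zero`), and there is no primitive character mod `2` (every character mod `2`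
is trivial, of conductor `1`). So the side conditions `2 ≤ q` above and the `3 ≤ q` of the
tree's `Literature.NumberTheory.LFunctions.NoSiegelZeros` cost nothing. [folklore] -/
theorem IsSiegelZero.three_le {q : ℕ} [NeZero q] {χ : DirichletCharacter ℂ q} {η : ℝ}
    (h : IsSiegelZero χ η) : 3 ≤ q := by
  obtain ⟨hprim, -, -, hL⟩ := h
  by_contra hlt
  rw [not_le] at hlt
  have h1 : 1 ≤ q := Nat.pos_of_ne_zero (NeZero.ne q)
  interval_cases q
  · -- `q = 1`: the clause is `ζ(1) = 0`
    rw [Nat.cast_one, Real.log_one, mul_zero, div_zero, sub_zero, Complex.ofReal_one,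
      DirichletCharacter.LFunction_modOne_eq] at hL
    exact riemannZeta_one_ne_zero hL
  · -- `q = 2`: every character mod `2` is trivial, hence imprimitive
    have hsub : Subsingleton (ZMod 2)ˣ := by
      refine Fintype.card_le_one_iff_subsingleton.mp ?_
      rw [ZMod.card_units_eq_totient, Nat.totient_two]
    have hχ : χ = 1 :=
      MulChar.ext fun a => by rw [Subsingleton.elim a 1, Units.val_one, map_one, map_one]
    rw [DirichletCharacter.isPrimitive_def, hχ, DirichletCharacter.conductor_one] at hprim
    omega

/-- The side condition `2 ≤ q` of `IsSiegelZero.one_half_lt_re` / `re_lt_one` discharged by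
`IsSiegelZero.three_le`: every Siegel zero is a real zero `β ∈ (1/2, 1)`. [folklore] -/
theorem IsSiegelZero.one_half_lt_re' {q : ℕ} [NeZero q] {χ : DirichletCharacter ℂ q} {η : ℝ}
    (h : IsSiegelZero χ η) :
    (1 : ℝ) / 2 < 1 - 1 / (η * Real.log q) ∧ 1 - 1 / (η * Real.log q) < (1 : ℝ) :=
  have hq : 2 ≤ q := le_of_lt h.three_le
  ⟨h.one_half_lt_re hq, h.re_lt_one hq⟩

/-- **`¬ UnboundedSiegelZeros` as a zero-free interval.** The quality of Siegel zeros is bounded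
from some conductor on (`not_unboundedSiegelZeros_iff`) iff there are `η₀ > 0` and `q₀` such that
`L(σ, χ) ≠ 0` for every `q ≥ q₀`, every primitive quadratic `χ mod q` and every real `σ` with
`1 - 1/(η₀ log q) ≤ σ < 1` — a Siegel-type zero-free interval with the EXPLICIT constant
`c = 1/η₀` at large conductors (the tree's `Literature.NumberTheory.LFunctions.NoSiegelZeros`,
rh.S34, asks this at every `q ≥ 3`; Siegel's theorem gives only the ineffective `η ≪_ε q_χ^ε`).
The point is that EVERY real zero `σ` in that interval is a Siegel zero in the sense of
Definition 1.4, of quality `η = 1/((1 - σ) log q) ≥ η₀`. [cite: TaoTeravainen2021, Definition 1.4 and (1.4)] -/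
theorem not_unboundedSiegelZeros_iff_zeroFree :
    ¬ Summit.Parity.GeneralizedHardyLittlewood.UnboundedSiegelZeros ↔
      ∃ η₀ : ℝ, 0 < η₀ ∧ ∃ q₀ : ℕ, ∀ (q : ℕ) [NeZero q] (χ : DirichletCharacter ℂ q),
        q₀ ≤ q → χ.IsPrimitive → χ.IsQuadratic →
          ∀ σ : ℝ, 1 - 1 / (η₀ * Real.log q) ≤ σ → σ < 1 → χ.LFunction σ ≠ 0 := by
  constructor
  · intro hnot
    unfold Summit.Parity.GeneralizedHardyLittlewood.UnboundedSiegelZeros at hnot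
    simp only [not_forall, not_exists, not_and] at hnot
    obtain ⟨η₀, q₀, hno⟩ := hnot
    refine ⟨max η₀ 10, by positivity, max q₀ 2, fun q _ χ hq hprim hquad σ hσ hσ1 hL => ?_⟩
    have hq2 : (2 : ℝ) ≤ q := by exact_mod_cast le_of_max_le_right hq
    have hlog : 0 < Real.log q := Real.log_pos (by linarith)
    have h1σ : 0 < 1 - σ := by linarith
    set η : ℝ := 1 / ((1 - σ) * Real.log q) with hη_def
    have hη0 : 0 < η := by positivity
    -- `σ = 1 - 1/(η log q)`
    have hpt : 1 - 1 / (η * Real.log q) = σ := by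
      rw [hη_def]
      field_simp
      ring
    -- `η ≥ max η₀ 10`
    have hηge : max η₀ 10 ≤ η := by
      have hm : 0 < max η₀ 10 := by positivity
      have h1 : 1 - σ ≤ 1 / (max η₀ 10 * Real.log q) := by linarith
      rw [hη_def, le_div_iff₀ (by positivity)]
      rw [le_div_iff₀ (by positivity)] at h1
      nlinarith
    refine hno q ‹_› χ η (le_of_max_le_left hq) (le_of_max_le_left hηge)
      ⟨hprim, hquad, le_of_max_le_right hηge, ?_⟩
    rw [hpt]
    exact hL
  · rintro ⟨η₀, hη₀, q₀, hZ⟩ hU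
    obtain ⟨q, _, χ, η, hq, hη, hprim, hquad, h10, hL⟩ := hU η₀ (max q₀ 2)
    have hq2 : (2 : ℝ) ≤ q := by exact_mod_cast le_of_max_le_right hq
    have hlog : 0 < Real.log q := Real.log_pos (by linarith)
    have hηpos : 0 < η := by linarith
    refine hZ q χ (le_of_max_le_left hq) hprim hquad _ ?_ ?_ hL
    · -- `1 - 1/(η₀ log q) ≤ 1 - 1/(η log q)`
      have : 1 / (η * Real.log q) ≤ 1 / (η₀ * Real.log q) :=
        one_div_le_one_div_of_le (by positivity) (by nlinarith)
      linarith
    · have : 0 < 1 / (η * Real.log q) := by positivity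
      linarith

/-- Hence the tree's open `Literature.NumberTheory.LFunctions.NoSiegelZeros` (rh.S34) yields the
zero-free form with `η₀ = 1/c`, `q₀ = 3` — the statement-file lemma
`not_unboundedSiegelZeros_of_noSiegelZeros` read through `not_unboundedSiegelZeros_iff_zeroFree`.
[folklore] -/
theorem zeroFree_of_noSiegelZeros (h : Literature.NumberTheory.LFunctions.NoSiegelZeros) :
    ∃ η₀ : ℝ, 0 < η₀ ∧ ∃ q₀ : ℕ, ∀ (q : ℕ) [NeZero q] (χ : DirichletCharacter ℂ q),
        q₀ ≤ q → χ.IsPrimitive → χ.IsQuadratic →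
          ∀ σ : ℝ, 1 - 1 / (η₀ * Real.log q) ≤ σ → σ < 1 → χ.LFunction σ ≠ 0 :=
  not_unboundedSiegelZeros_iff_zeroFree.mp (not_unboundedSiegelZeros_of_noSiegelZeros h)

end Literature.Barriers.Parity
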